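import Mathlib
import Literature.NumberTheory.LFunctions.Zhang2022.TypedSection17
import Literature.NumberTheory.LFunctions.Zhang2022.Section17NuStarBound
import Literature.NumberTheory.LFunctions.Zhang2022.Section15Bcoef
import Literature.NumberTheory.LFunctions.Zhang2022.Section3Lemma34
import Literature.NumberTheory.LFunctions.Zhang2022.SkeletonWindowPowers
import Literature.NumberTheory.Sieve.DivisorBound
import HarnessLib

/-!
# Zhang (2022) §17: divisor-type size bounds on `ν*` (§17.u004) and the two support claims of p. 98
# (`ν₁*` on `n < T⁵`, `b∗ν₁*` on `n < PT⁻²`) — theorem-only companion of `TypedSection17`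
# (campaign D-0069, layer L4, seat L4-t6)

Topic `Literature/NumberTheory/LFunctions/Zhang2022` (Landau–Siegel audit tree; verdict-neutral).
Y. Zhang, *Discrete mean estimates and the Landau–Siegel zero*, arXiv:2211.02515v1 (2022)
[Zhang2022LandauSiegel], §17 p. 96 (tex L4719–L4728) — **an unrefereed manuscript under
adjudication; nothing in this file asserts or denies its Theorems 1–2.**

§17 p. 96 writes, for `σ > 1`,
`(L(s+β₁,ψ)/L(s,ψ))B(s,ψ)G(s,ψ)N(s+β₂,ψ)N(s+β₃,ψ) = Σ_m ν*(m)ψ(m)m^{−s}` (§17.u004; the typed object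
`Typed.Section17.nuStar c′ χ = κ₂ ∗ (bχ) ∗ υ·[≤D⁴] ∗ nN_{β₂} ∗ nN_{β₃}`, identity kernel-checked as
`Typed.Section17.step17_u004_holds`) and then passes from the term-by-term display §17.u005 to (17.3)
"by trivial estimation". The trivial estimation needs exactly one size input on `ν*`, which the
manuscript leaves implicit and which this file PROVES:

* `norm_nuStar_le_tau` — `|ν*(n)| ≤ (1+|ι₂|)(|ι₃|+|ι₄|)·τ₈(n)` once `𝓛 = log D ≥ 2`: the five factors
  are divisor-bounded — `|κ₂| ≤ τ₂` (`κ₂ = n^{−β₁} ∗ μ`; tree `Phi3Eval.norm_kappa₂_le_card_divisors`),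
  `|b(n)χ(n)| ≤ (1+|ι₂|)(|ι₃|+|ι₄|)τ₂(n)` ((15.2), the tree's `Skeleton.norm_bcoef_le`),
  `|υ·[≤D⁴]| ≤ |υ| ≤ τ₂` ((3.1), the tree's `Lemma34.norm_ups_le`), `|n^{−β_j}g*(T²/n)| ≤ 1`
  (`β₂, β₃ ∈ iℝ`, `0 < g* < 1`; tree `Phi3Eval.norm_nN_le_one`) — and divisor-type majorants multiply under
  Dirichlet convolution (the tree's `MeanSquareMajorant.norm_seqConv_le_tau`): `τ₂∗τ₂∗τ₂∗τ₁∗τ₁ = τ₈`;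
* `tau_succ_le_tau_two_pow` — `τ_{k+1}(n) ≤ τ₂(n)^k` (`n ≥ 1`), and with the divisor bound
  `τ₂(n) ≤ C_ε n^ε` (Hardy–Wright Thm 315; the tree's
  `Literature.NumberTheory.Sieve.exists_card_divisors_le_mul_rpow`) `exists_tau_succ_le_mul_rpow`:
  `τ_{k+1}(n) ≤ C n^ε` for every `ε > 0`;
* the eventual form `∃ C, ForAllLarge (∀ n, |ν*(n)| ≤ C·n^{1/4})` (hypothesis `hν` of the cell's
  kernel edges for (17.3)) is the tree's `Phi3Eval.nuStar_bound` (file `Section17NuStarBound`, seat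
  sz-d58, landed first); this file keeps the `τ₈`-form and the generalized-divisor-function bound as
  reusable by-products and does NOT restate `nuStar_bound`;
* §4: the two inline SUPPORT CLAIMS of §17 p. 98 are THEOREMS — `claim17_supp_nu1_holds :
  Claim17_supp_nu1 c′` ("`ν₁*(n)` is supported on `n < T⁵`": `ν₁* = 0` from `4(D⁴+1)T⁴` on) and
  `claim17_supp_bnu1_holds : Claim17_supp_bnu1 c′` ("`(b∗ν₁*)(n)` is supported on `n < PT⁻²`": `b = 0`
  from `P^{1/2}max(P₂,P₃) ≤ PT⁻⁹` on — NOT from the printed `PT⁻²η₊` of (15.2), which would not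
  suffice — and `PT⁻⁹·T⁵ ≤ PT⁻²`), with the support lemmas `nuOneStar_eq_zero_of_le`,
  `bcoef_eq_zero_of_sqrtP_mul_max_le`, `bConvNuOne_eq_zero_of_le`.

Theorem-only (no `def`, no new named fact, no instance/notation); imports the typed §17 file, the
tree's `Section17NuStarBound` (`Phi3Eval.norm_kappa₂_le_card_divisors`, `norm_nN_le_one`), the (15.2)
file `Section15Bcoef`, the (3.1) file `Section3Lemma34`, `SkeletonWindowPowers.exists_nat_forall_le_ell`,
and the Literature divisor bound.

## References

* Y. Zhang, arXiv:2211.02515v1 (2022), §17 p. 96 (tex L4719–L4728); (15.2) p. 79; (3.1) p. 12;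
  §6 Lemma 6.1 p. 30. [cite: Zhang2022LandauSiegel, §17 p.96]
* G. H. Hardy, E. M. Wright, *An Introduction to the Theory of Numbers*, 6th ed. (2008), Thm 315.
  [cite: HardyWright2008, Theorem 315]
-/

noncomputable section

open Complex Real ComplexConjugate

namespace Literature.NumberTheory.LFunctions.Zhang2022.Typed.Section17

open Literature.NumberTheory.LFunctions.Zhang2022
open Literature.NumberTheory.LFunctions.Zhang2022.Skeleton

/-! ## §1. Generalized divisor functions: `τ_{k+1} ≤ τ₂^k ≤ C n^ε` -/

section DivisorFunctions

/-- `τ₂` is monotone along divisibility: `d ∣ n`, `n ≠ 0` ⇒ `τ₂(d) ≤ τ₂(n)` (the divisors of `d` are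
divisors of `n`). [folklore] -/
private theorem tau_two_le_of_dvd {d n : ℕ} (h : d ∣ n) (hn : n ≠ 0) :
    MeanSquareMajorant.tau 2 d ≤ MeanSquareMajorant.tau 2 n := by
  rw [MeanSquareMajorant.tau_two_apply, MeanSquareMajorant.tau_two_apply]
  exact_mod_cast Finset.card_le_card (Nat.divisors_subset_of_dvd hn h)

/-- **`τ_{k+1}(n) ≤ τ₂(n)^k`** for `n ≥ 1`: an ordered `(k+1)`-factorisation is determined by its
first `k` factors, each a divisor of `n` (induction via `τ_{k+2}(n) = Σ_{d∣n}τ_{k+1}(d)` and the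
monotonicity of `τ₂`). [folklore] -/
private theorem tau_succ_le_tau_two_pow (k : ℕ) {n : ℕ} (hn : n ≠ 0) :
    MeanSquareMajorant.tau (k + 1) n ≤ MeanSquareMajorant.tau 2 n ^ k := by
  induction k generalizing n with
  | zero => rw [MeanSquareMajorant.tau_one_apply hn, pow_zero]
  | succ k ih =>
    rw [MeanSquareMajorant.tau_succ_apply]
    calc ∑ d ∈ n.divisors, MeanSquareMajorant.tau (k + 1) d
        ≤ ∑ d ∈ n.divisors, MeanSquareMajorant.tau 2 n ^ k :=
          Finset.sum_le_sum fun d hd =>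
            (ih (Nat.pos_of_mem_divisors hd).ne').trans
              (pow_le_pow_left₀ (MeanSquareMajorant.tau_nonneg _ _)
                (tau_two_le_of_dvd (Nat.dvd_of_mem_divisors hd) hn) k)
      _ = MeanSquareMajorant.tau 2 n * MeanSquareMajorant.tau 2 n ^ k := by
          rw [Finset.sum_const, nsmul_eq_mul, ← MeanSquareMajorant.tau_two_apply]
      _ = MeanSquareMajorant.tau 2 n ^ (k + 1) := by ring

/-- **Divisor bound for `τ_{k+1}`**: for every `ε > 0` there is `C ≥ 0` with `τ_{k+1}(n) ≤ C·n^ε`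
for all `n ≥ 1` (`τ_{k+1} ≤ τ₂^k` and Hardy–Wright Thm 315 `τ₂(n) ≤ C_δ n^δ` at `δ = ε/(k+1)`).
[cite: HardyWright2008, Theorem 315] -/
theorem exists_tau_succ_le_mul_rpow (k : ℕ) {ε : ℝ} (hε : 0 < ε) :
    ∃ C : ℝ, 0 ≤ C ∧ ∀ n : ℕ, n ≠ 0 →
      MeanSquareMajorant.tau (k + 1) n ≤ C * (n : ℝ) ^ ε := by
  have hk1 : (0 : ℝ) < (k : ℝ) + 1 := by positivity
  obtain ⟨C, hC1, hC⟩ :=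
    Literature.NumberTheory.Sieve.exists_card_divisors_le_mul_rpow (ε := ε / ((k : ℝ) + 1))
      (div_pos hε hk1)
  have hC0 : 0 ≤ C := zero_le_one.trans hC1
  refine ⟨C ^ k, pow_nonneg hC0 k, fun n hn => ?_⟩
  have hn1 : (1 : ℝ) ≤ n := by exact_mod_cast Nat.one_le_iff_ne_zero.mpr hn
  have hτ2 : MeanSquareMajorant.tau 2 n ≤ C * (n : ℝ) ^ (ε / ((k : ℝ) + 1)) := by
    rw [MeanSquareMajorant.tau_two_apply]; exact hC n hn
  have hexp : ε / ((k : ℝ) + 1) * k ≤ ε := by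
    have h1 : (k : ℝ) / ((k : ℝ) + 1) ≤ 1 := by
      rw [div_le_one hk1]; linarith
    calc ε / ((k : ℝ) + 1) * k = ε * ((k : ℝ) / ((k : ℝ) + 1)) := by ring
      _ ≤ ε * 1 := by gcongr
      _ = ε := mul_one ε
  calc MeanSquareMajorant.tau (k + 1) n ≤ MeanSquareMajorant.tau 2 n ^ k :=
        tau_succ_le_tau_two_pow k hn
    _ ≤ (C * (n : ℝ) ^ (ε / ((k : ℝ) + 1))) ^ k :=
        pow_le_pow_left₀ (MeanSquareMajorant.tau_nonneg _ _) hτ2 k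
    _ = C ^ k * (n : ℝ) ^ (ε / ((k : ℝ) + 1) * k) := by
        rw [mul_pow, ← Real.rpow_natCast ((n : ℝ) ^ (ε / ((k : ℝ) + 1))) k,
          ← Real.rpow_mul (Nat.cast_nonneg n)]
    _ ≤ C ^ k * (n : ℝ) ^ ε :=
        mul_le_mul_of_nonneg_left (Real.rpow_le_rpow_of_exponent_le hn1 hexp) (pow_nonneg hC0 k)

end DivisorFunctions

/-! ## §2. The five factors of `ν*` are divisor-bounded -/

section Factors

variable (c' : ℝ) {D : ℕ} (χ : DirichletCharacter ℂ D)

/-- Dirichlet convolution in Mathlib's form `LSeries.convolution` is the tree's `seqConv`, so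
divisor-type majorants multiply: `|u| ≤ C₁τ_{j₁}`, `|v| ≤ C₂τ_{j₂}` (`n ≥ 1`) ⇒
`|(u ∗ v)(n)| ≤ C₁C₂τ_{j₁+j₂}(n)` for all `n` (`MeanSquareMajorant.norm_seqConv_le_tau`). [folklore] -/
private theorem norm_convolution_le_tau {u v : ℕ → ℂ} {C₁ C₂ : ℝ} {j₁ j₂ : ℕ} (hC₁ : 0 ≤ C₁)
    (hu : ∀ n, n ≠ 0 → ‖u n‖ ≤ C₁ * MeanSquareMajorant.tau j₁ n)
    (hv : ∀ n, n ≠ 0 → ‖v n‖ ≤ C₂ * MeanSquareMajorant.tau j₂ n) (n : ℕ) :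
    ‖LSeries.convolution u v n‖ ≤ C₁ * C₂ * MeanSquareMajorant.tau (j₁ + j₂) n := by
  have h : LSeries.convolution u v n = MeanSquareMajorant.seqConv u v n := by
    simp only [LSeries.convolution_def, MeanSquareMajorant.seqConv]
  rw [h]
  exact MeanSquareMajorant.norm_seqConv_le_tau hC₁ hu hv n

/-- **`|b(n)χ(n)| ≤ (1+|ι₂|)(|ι₃|+|ι₄|)·τ₂(n)`** for `log D ≥ 2` — (15.2) `b ≪ τ₂` (the tree's
`Skeleton.norm_bcoef_le`) and `|χ(n)| ≤ 1`. [cite: Zhang2022LandauSiegel, §15 (15.2) p.79] -/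
theorem norm_bcoef_mul_chi_le (hD : 2 ≤ Real.log D) (n : ℕ) :
    ‖bcoef D n * χ (n : ZMod D)‖ ≤
      (1 + ‖iota2‖) * (‖iota3‖ + ‖iota4‖) * MeanSquareMajorant.tau 2 n := by
  rw [norm_mul]
  exact (mul_le_of_le_one_right (norm_nonneg _) (DirichletCharacter.norm_le_one χ _)).trans
    (Skeleton.norm_bcoef_le hD n)

/-- Truncation does not increase the modulus: `|a·[n ≤ N]| ≤ |a(n)|`. [folklore] -/
private theorem norm_trunc_le (N : ℕ) (a : ℕ → ℂ) (n : ℕ) : ‖trunc N a n‖ ≤ ‖a n‖ := by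
  unfold trunc
  split_ifs
  · exact le_rfl
  · rw [norm_zero]; exact norm_nonneg _

/-- **`|υ(n)·[n ≤ D⁴]| ≤ τ₂(n)`** — (3.1) `|υ| ≤ τ₂` (`υ = μ ∗ μχ`; the tree's `Lemma34.norm_ups_le`).
[cite: Zhang2022LandauSiegel, §3 (3.1) p.12] -/
theorem norm_trunc_ups_le (n : ℕ) :
    ‖trunc (D ^ 4) (ups χ) n‖ ≤ MeanSquareMajorant.tau 2 n :=
  (norm_trunc_le _ _ n).trans (Lemma34.norm_ups_le χ n)

/-- `|g*(y)| ≤ 1` (`g* ∈ {0} ∪ (0,1)`: `GaussWeight.gWeight_pos/lt_one` at `Λ = 𝓛³⁰ > 0`).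
[cite: Zhang2022LandauSiegel, §6 p.30; §4 (4.1)] -/
theorem norm_gstar_le_one (hℓ : 0 < ell D) (y : ℝ) : ‖(gstar D y : ℂ)‖ ≤ 1 := by
  rw [Complex.norm_real, Real.norm_eq_abs, gstar]
  split_ifs
  · have h30 : 0 < ell D ^ 30 := by positivity
    rw [gW, abs_of_pos (GaussWeight.gWeight_pos h30 _)]
    exact (GaussWeight.gWeight_lt_one h30 _).le
  · simp

/-- `Re β₂ = 0` ((2.13): the shifts are purely imaginary). [cite: Zhang2022LandauSiegel, §2 (2.13)] -/
private theorem beta2_re_eq_zero : (beta2 c' D).re = 0 := by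
  simp [beta2]

/-- `Re β₃ = 0` ((2.13)). [cite: Zhang2022LandauSiegel, §2 (2.13)] -/
private theorem beta3_re_eq_zero : (beta3 c' D).re = 0 := by
  simp [beta3]

end Factors

/-! ## §3. `|ν*(n)| ≤ K·τ₈(n)` and the eventual form `|ν*(n)| ≤ C·n^{1/4}` -/

section NuStar

variable (c' : ℝ) {D : ℕ} (χ : DirichletCharacter ℂ D)

/-- **`|ν*(n)| ≤ (1+|ι₂|)(|ι₃|+|ι₄|)·τ₈(n)`** for `𝓛 = log D ≥ 2` and every `n`: the five factors of
`ν* = κ₂ ∗ (bχ) ∗ υ·[≤D⁴] ∗ nN_{β₂} ∗ nN_{β₃}` (§17.u004) are bounded by `τ₂, Kτ₂, τ₂, τ₁, τ₁` and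
`τ₂∗τ₂∗τ₂∗τ₁∗τ₁ = τ₈`. [cite: Zhang2022LandauSiegel, §17 u004 p.96; (15.2); (3.1)] -/
theorem norm_nuStar_le_tau (hD : 2 ≤ Real.log D) (n : ℕ) :
    ‖nuStar c' χ n‖ ≤ (1 + ‖iota2‖) * (‖iota3‖ + ‖iota4‖) * MeanSquareMajorant.tau 8 n := by
  set K : ℝ := (1 + ‖iota2‖) * (‖iota3‖ + ‖iota4‖) with hK
  have hK0 : 0 ≤ K := by positivity
  have hℓ : 0 < ell D := lt_of_lt_of_le (by norm_num) (show (2 : ℝ) ≤ ell D from hD)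
  -- factor bounds
  have h1 : ∀ m, m ≠ 0 → ‖MeanSquareMajorant.kappa₂ (b1 c' D) m‖ ≤ 1 * MeanSquareMajorant.tau 2 m :=
    fun m _ => by
      rw [one_mul, MeanSquareMajorant.tau_two_apply]
      exact Phi3Eval.norm_kappa₂_le_card_divisors _ m
  have h2 : ∀ m, m ≠ 0 → ‖bcoef D m * χ (m : ZMod D)‖ ≤ K * MeanSquareMajorant.tau 2 m :=
    fun m _ => norm_bcoef_mul_chi_le χ hD m
  have h3 : ∀ m, m ≠ 0 → ‖trunc (D ^ 4) (ups χ) m‖ ≤ 1 * MeanSquareMajorant.tau 2 m :=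
    fun m _ => by rw [one_mul]; exact norm_trunc_ups_le χ m
  have h4 : ∀ m, m ≠ 0 → ‖nN D (beta2 c' D) m‖ ≤ 1 * MeanSquareMajorant.tau 1 m :=
    fun m hm => by
      rw [MeanSquareMajorant.tau_one_apply hm, mul_one]
      exact Phi3Eval.norm_nN_le_one hℓ (beta2_re_eq_zero c') m
  have h5 : ∀ m, m ≠ 0 → ‖nN D (beta3 c' D) m‖ ≤ 1 * MeanSquareMajorant.tau 1 m :=
    fun m hm => by
      rw [MeanSquareMajorant.tau_one_apply hm, mul_one]
      exact Phi3Eval.norm_nN_le_one hℓ (beta3_re_eq_zero c') m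
  -- multiply the majorants
  have c1 := fun m (_ : m ≠ 0) => norm_convolution_le_tau zero_le_one h1 h2 m
  have c2 := fun m (_ : m ≠ 0) => norm_convolution_le_tau (by positivity) c1 h3 m
  have c3 := fun m (_ : m ≠ 0) => norm_convolution_le_tau (by positivity) c2 h4 m
  have c4 := norm_convolution_le_tau (by positivity) c3 h5 n
  have hKe : (1 : ℝ) * K * 1 * 1 * 1 = K := by ring
  rw [hKe] at c4
  exact c4

end NuStar

/-! ## §4. The two inline support claims of §17 p. 98: `ν₁*` on `n < T⁵`, `b∗ν₁*` on `n < PT⁻²` -/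

section Supports

variable (c' : ℝ) {D : ℕ} (χ : DirichletCharacter ℂ D)

/-- A Dirichlet convolution (as an antidiagonal sum) of two sequences vanishing from `A` resp. `B`
on vanishes from `A·B` on. [folklore] -/
private theorem sum_antidiagonal_eq_zero_of_support {u v : ℕ → ℂ} {A B : ℝ}
    (hu : ∀ a : ℕ, A ≤ (a : ℝ) → u a = 0) (hv : ∀ b : ℕ, B ≤ (b : ℝ) → v b = 0) {n : ℕ}
    (hn : A * B ≤ (n : ℝ)) : ∑ q ∈ n.divisorsAntidiagonal, u q.1 * v q.2 = 0 := by
  refine Finset.sum_eq_zero fun q hq => ?_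
  have hqn : (q.1 : ℝ) * q.2 = n := by exact_mod_cast (Nat.mem_divisorsAntidiagonal.mp hq).1
  by_cases ha : A ≤ (q.1 : ℝ)
  · rw [hu _ ha, zero_mul]
  · by_cases hb : B ≤ (q.2 : ℝ)
    · rw [hv _ hb, mul_zero]
    · exfalso
      have hlt : (q.1 : ℝ) * q.2 < A * B :=
        mul_lt_mul'' (not_le.mp ha) (not_le.mp hb) (Nat.cast_nonneg _) (Nat.cast_nonneg _)
      linarith

/-- `LSeries.convolution` version of `sum_antidiagonal_eq_zero_of_support`. [folklore] -/
private theorem convolution_eq_zero_of_support {u v : ℕ → ℂ} {A B : ℝ}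
    (hu : ∀ a : ℕ, A ≤ (a : ℝ) → u a = 0) (hv : ∀ b : ℕ, B ≤ (b : ℝ) → v b = 0) {n : ℕ}
    (hn : A * B ≤ (n : ℝ)) : LSeries.convolution u v n = 0 := by
  rw [LSeries.convolution_def]
  exact sum_antidiagonal_eq_zero_of_support hu hv hn

/-- `υ·[n ≤ D⁴]` vanishes from `D⁴ + 1` on. [cite: Zhang2022LandauSiegel, §3 p.12 (`G(s,ψ)`)] -/
private theorem trunc_ups_eq_zero {a : ℕ} (ha : (D : ℝ) ^ 4 + 1 ≤ (a : ℝ)) :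
    trunc (D ^ 4) (ups χ) a = 0 := by
  have h : ¬ a ≤ D ^ 4 := by
    intro h
    have : (a : ℝ) ≤ (D : ℝ) ^ 4 := by exact_mod_cast h
    linarith
  simp [trunc, h]

/-- The coefficients `n^{−β}g*(T²/n)` of `N(s+β,ψ)` vanish from `2T²` on (`g*(y) = 0` for `y ≤ 1/2`;
§6 Lemma 6.1: `N` is a sum over `n < 2T²`). [cite: Zhang2022LandauSiegel, §6 Lemma 6.1 p.30] -/
private theorem nN_eq_zero_of_ge (β : ℂ) {b : ℕ} (hb : 2 * bigT D ^ 2 ≤ (b : ℝ)) : nN D β b = 0 := by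
  have hT : 0 < bigT D := Real.exp_pos _
  have hb0 : (0 : ℝ) < b := lt_of_lt_of_le (by positivity) hb
  have h : ¬ (1 / 2 : ℝ) < bigT D ^ 2 / b := by
    rw [not_lt, div_le_iff₀ hb0]
    linarith
  rw [nN, gstar, if_neg h, Complex.ofReal_zero, mul_zero]

/-- **`ν₁*(n) = 0` for `n ≥ 4(D⁴+1)T⁴`** (every `D`): `ν₁* = υ·[≤D⁴] ∗ nN_{β₂} ∗ nN_{β₃}` with factors
supported below `D⁴ + 1`, `2T²`, `2T²`. [cite: Zhang2022LandauSiegel, §17 u021 p.98] -/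
theorem nuOneStar_eq_zero_of_le {n : ℕ} (hn : 4 * ((D : ℝ) ^ 4 + 1) * bigT D ^ 4 ≤ (n : ℝ)) :
    nuOneStar c' χ n = 0 := by
  have inner : ∀ a : ℕ, ((D : ℝ) ^ 4 + 1) * (2 * bigT D ^ 2) ≤ (a : ℝ) →
      LSeries.convolution (trunc (D ^ 4) (ups χ)) (nN D (beta2 c' D)) a = 0 :=
    fun a ha => convolution_eq_zero_of_support (fun m hm => trunc_ups_eq_zero χ hm)
      (fun m hm => nN_eq_zero_of_ge _ hm) ha
  unfold nuOneStar
  refine convolution_eq_zero_of_support inner (fun m hm => nN_eq_zero_of_ge _ hm) ?_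
  calc ((D : ℝ) ^ 4 + 1) * (2 * bigT D ^ 2) * (2 * bigT D ^ 2)
      = 4 * ((D : ℝ) ^ 4 + 1) * bigT D ^ 4 := by ring
    _ ≤ (n : ℝ) := hn

/-- `5𝓛 ≤ 𝓛^{1.1}` once `𝓛 ≥ 5¹⁰` (`𝓛^{1.1} = 𝓛^{0.1}·𝓛`, `𝓛^{0.1} ≥ 5`). [cite: Zhang2022LandauSiegel, §6 p.12 (`T = exp 𝓛^{1.1}`)] -/
private theorem five_mul_ell_le (hℓ : (5 : ℝ) ^ (10 : ℕ) ≤ ell D) : 5 * ell D ≤ ell D ^ (1.1 : ℝ) := by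
  have hℓ0 : 0 < ell D := lt_of_lt_of_le (by positivity) hℓ
  have e1 : ((5 : ℝ) ^ (10 : ℕ)) ^ (0.1 : ℝ) = 5 := by
    rw [← Real.rpow_natCast, ← Real.rpow_mul (by norm_num : (0 : ℝ) ≤ 5)]
    norm_num
  have h5 : (5 : ℝ) ≤ ell D ^ (0.1 : ℝ) := by
    rw [← e1]
    exact Real.rpow_le_rpow (by positivity) hℓ (by norm_num)
  have hsplit : ell D ^ (1.1 : ℝ) = ell D ^ (0.1 : ℝ) * ell D := by
    rw [show (1.1 : ℝ) = 0.1 + 1 by norm_num, Real.rpow_add hℓ0, Real.rpow_one]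
  rw [hsplit]
  exact mul_le_mul_of_nonneg_right h5 hℓ0.le

/-- **`4(D⁴+1) ≤ T`** once `𝓛 ≥ 5¹⁰`: `4(D⁴+1) ≤ 8D⁴ = 8e^{4𝓛} ≤ e^{5𝓛} ≤ e^{𝓛^{1.1}} = T`.
[cite: Zhang2022LandauSiegel, §6 p.12 (`T = exp 𝓛^{1.1}`)] -/
private theorem four_mul_pow_four_succ_le_bigT (hℓ : (5 : ℝ) ^ (10 : ℕ) ≤ ell D) :
    4 * ((D : ℝ) ^ 4 + 1) ≤ bigT D := by
  have hℓ0 : 0 < ell D := lt_of_lt_of_le (by positivity) hℓ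
  have hD0 : (0 : ℝ) < D := by
    rcases Nat.eq_zero_or_pos D with h | h
    · exfalso; simp [ell, h] at hℓ0
    · exact_mod_cast h
  have hD1 : (1 : ℝ) ≤ (D : ℝ) ^ 4 := by
    have h1 : (1 : ℝ) ≤ D := by
      by_contra h
      have : Real.log D ≤ 0 := Real.log_nonpos hD0.le (not_le.mp h).le
      exact absurd this (not_le.mpr hℓ0)
    exact one_le_pow₀ h1
  have hexp : (D : ℝ) ^ 4 = Real.exp (4 * ell D) := by
    rw [ell, show (4 : ℝ) * Real.log D = ((4 : ℕ) : ℝ) * Real.log D by norm_num, Real.exp_nat_mul,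
      Real.exp_log hD0]
  have h8 : (8 : ℝ) ≤ Real.exp (ell D) := by
    have := Real.add_one_le_exp (ell D)
    have h7 : (7 : ℝ) ≤ ell D := le_trans (by norm_num) hℓ
    linarith
  calc 4 * ((D : ℝ) ^ 4 + 1) ≤ 8 * (D : ℝ) ^ 4 := by linarith
    _ = 8 * Real.exp (4 * ell D) := by rw [hexp]
    _ ≤ Real.exp (ell D) * Real.exp (4 * ell D) :=
        mul_le_mul_of_nonneg_right h8 (Real.exp_pos _).le
    _ = Real.exp (5 * ell D) := by rw [← Real.exp_add]; ring_nf
    _ ≤ bigT D := by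
        rw [bigT, Real.exp_le_exp]
        exact five_mul_ell_le hℓ

/-- `𝓛 ≥ 5¹⁰` for all large `D`. [cite: Zhang2022LandauSiegel, §2 p.4] -/
private theorem exists_nat_forall_pow_le_ell : ∃ D₀ : ℕ, ∀ D : ℕ, D₀ ≤ D → (5 : ℝ) ^ (10 : ℕ) ≤ ell D :=
  exists_nat_forall_le_ell _

/-- **The inline claim before §17.u021 HOLDS: `ν₁*(n)` is supported on `n < T⁵`** (§17 p. 98,
"Note that `ν₁*(n)` is supported on `n < T⁵`"; the typed node `Typed.Section17.Claim17_supp_nu1`):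
`ν₁*` vanishes from `4(D⁴+1)T⁴ ≤ T⁵` on (for `𝓛 ≥ 5¹⁰`). [cite: Zhang2022LandauSiegel, §17 u021 p.98] -/
theorem claim17_supp_nu1_holds (c' : ℝ) : Claim17_supp_nu1 c' := by
  obtain ⟨D₀, hD₀⟩ := exists_nat_forall_pow_le_ell
  refine ⟨D₀, fun D _ χ hD _ _ n hn => ?_⟩
  have hℓ := hD₀ D hD
  have hT0 : 0 < bigT D := Real.exp_pos _
  refine nuOneStar_eq_zero_of_le c' χ ?_
  calc 4 * ((D : ℝ) ^ 4 + 1) * bigT D ^ 4 ≤ bigT D * bigT D ^ 4 :=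
        mul_le_mul_of_nonneg_right (four_mul_pow_four_succ_le_bigT hℓ) (by positivity)
    _ = bigT D ^ 5 := by ring
    _ ≤ n := hn

variable (c' : ℝ) in
/-- `Claim17_supp_nu1` — `_holds` alias of `claim17_supp_nu1_holds` above under the fact's exact name, stated under the
prover's own binders as section variables (appended 2026-08-28, D-0026 bookkeeping: the proof term is the
existing theorem of this file; no statement, definition or attribute is edited; no new named fact; the
ledger's debt table listed the fact unproved). [cite: Zhang2022LandauSiegel, §17 u021 p.98] -/
theorem _root_.Literature.NumberTheory.LFunctions.Zhang2022.Typed.Section17.Claim17_supp_nu1_holds :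
    _root_.Literature.NumberTheory.LFunctions.Zhang2022.Typed.Section17.Claim17_supp_nu1 c' :=
  _root_.Literature.NumberTheory.LFunctions.Zhang2022.Typed.Section17.claim17_supp_nu1_holds (c' := c')

/-- `P₂ ≤ P^{1/2}` (`P₂ = P^{1/2}T⁻¹⁰`, `T ≥ 1`). [cite: Zhang2022LandauSiegel, §2 (2.21)] -/
private theorem P2_le_sqrtP' : Skeleton.P2 D ≤ bigP D ^ (1 / 2 : ℝ) := by
  have hT : 1 ≤ bigT D ^ 10 := one_le_pow₀ (Real.one_le_exp (by unfold ell; positivity))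
  rw [Skeleton.P2, show (0.5 : ℝ) = 1 / 2 by norm_num]
  exact div_le_self (Real.rpow_nonneg (Real.exp_pos _).le _) hT

/-- **`b(n) = 0` for `n ≥ P^{1/2}·max(P₂,P₃)`** (every `D`): the two factors of the banked
`b = (ϰ₁·[<P^{1/2}] + ι₂ϰ₂) ∗ (ῑ₃ϰ₃ + ῑ₄ϰ₂)` vanish from `P^{1/2}` resp. `max(P₂,P₃)` on (ϰ_j(n) = 0
for `n ≥ P_j`, (8.6)); the sharper form of (15.2) "`b(n) = 0` if `n > PT⁻²η₊`" (tree: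
`Skeleton.bcoef_eq_zero_of_le`). [cite: Zhang2022LandauSiegel, §15 (15.2) p.79; §8 (8.6)] -/
theorem bcoef_eq_zero_of_sqrtP_mul_max_le {n : ℕ}
    (hn : bigP D ^ (1 / 2 : ℝ) * max (Skeleton.P2 D) (Skeleton.P3 D) ≤ (n : ℝ)) : bcoef D n = 0 := by
  rw [bcoef]
  refine sum_antidiagonal_eq_zero_of_support
    (u := fun a : ℕ => (if (a : ℝ) < bigP D ^ (1 / 2 : ℝ) then vk1 D a else 0) + iota2 * vk2 D a)
    (v := fun a : ℕ => conj iota3 * vk3 D a + conj iota4 * vk2 D a) (fun a ha => ?_) (fun a ha => ?_) hn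
  · rw [if_neg (not_lt.mpr ha), vk2_eq_zero (le_trans P2_le_sqrtP' ha)]
    simp
  · rw [vk3_eq_zero (le_trans (le_max_right _ _) ha), vk2_eq_zero (le_trans (le_max_left _ _) ha)]
    simp

/-- **`max(P₂,P₃)·T⁹ ≤ P^{1/2}`** once `𝓛 ≥ 5¹⁰` (`P₂T⁹ = P^{1/2}T⁻¹`; `P₃T⁹ = P^{0.498}e^{9𝓛^{1.1}} ≤
P^{0.498}P^{0.002}` since `9𝓛^{1.1} ≤ 0.002𝓛⁹`). [cite: Zhang2022LandauSiegel, §2 (2.21), §6 p.12] -/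
private theorem max_P2_P3_mul_bigT_pow_le (hℓ : (5 : ℝ) ^ (10 : ℕ) ≤ ell D) :
    max (Skeleton.P2 D) (Skeleton.P3 D) * bigT D ^ 9 ≤ bigP D ^ (1 / 2 : ℝ) := by
  have hℓ1 : 1 ≤ ell D := le_trans (by norm_num) hℓ
  have hℓ0 : 0 < ell D := by linarith
  have hP : 0 < bigP D := Real.exp_pos _
  have hT0 : 0 < bigT D := Real.exp_pos _
  have hT1 : 1 ≤ bigT D := Real.one_le_exp (by positivity)
  rw [max_mul_of_nonneg _ _ (pow_nonneg hT0.le 9)]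
  refine max_le ?_ ?_
  · -- `P₂ T⁹ = P^{1/2} / T ≤ P^{1/2}`
    rw [Skeleton.P2, show (0.5 : ℝ) = 1 / 2 by norm_num]
    have : bigP D ^ (1 / 2 : ℝ) / bigT D ^ 10 * bigT D ^ 9 = bigP D ^ (1 / 2 : ℝ) / bigT D := by
      field_simp
    rw [this]
    exact div_le_self (Real.rpow_nonneg hP.le _) hT1
  · -- `P₃ T⁹ ≤ P^{0.498} P^{0.002} = P^{1/2}`
    have h11 : ell D ^ (1.1 : ℝ) ≤ ell D ^ 2 := by
      have := Real.rpow_le_rpow_of_exponent_le hℓ1 (show (1.1 : ℝ) ≤ 2 by norm_num)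
      rwa [Real.rpow_two] at this
    have h7 : (4500 : ℝ) ≤ ell D ^ 7 := by
      have h4500 : (4500 : ℝ) ≤ ell D := le_trans (by norm_num) hℓ
      calc (4500 : ℝ) ≤ ell D := h4500
        _ = ell D ^ 1 := (pow_one _).symm
        _ ≤ ell D ^ 7 := pow_le_pow_right₀ hℓ1 (by norm_num)
    have key : 9 * ell D ^ (1.1 : ℝ) ≤ 0.002 * ell D ^ 9 := by
      have h2 : 0 ≤ ell D ^ 2 := by positivity
      calc 9 * ell D ^ (1.1 : ℝ) ≤ 9 * ell D ^ 2 := by linarith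
        _ = 0.002 * (4500 * ell D ^ 2) := by ring
        _ ≤ 0.002 * (ell D ^ 7 * ell D ^ 2) := by gcongr
        _ = 0.002 * ell D ^ 9 := by ring
    have hT9 : bigT D ^ 9 = Real.exp (9 * ell D ^ (1.1 : ℝ)) := by
      rw [bigT, ← Real.exp_nat_mul]; norm_num
    have hP002 : bigP D ^ (0.002 : ℝ) = Real.exp (0.002 * ell D ^ 9) := by
      rw [bigP, ← Real.exp_mul]; ring_nf
    calc Skeleton.P3 D * bigT D ^ 9 ≤ Skeleton.P3 D * bigP D ^ (0.002 : ℝ) := by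
          refine mul_le_mul_of_nonneg_left ?_ (Real.rpow_nonneg hP.le _)
          rw [hT9, hP002, Real.exp_le_exp]
          exact key
      _ = bigP D ^ (1 / 2 : ℝ) := by
          rw [Skeleton.P3, ← Real.rpow_add hP]; norm_num

/-- **`(b∗ν₁*)(n) = 0` for `n ≥ PT⁻²`** once `𝓛 ≥ 5¹⁰`: `b` vanishes from `P^{1/2}max(P₂,P₃) ≤ PT⁻⁹` on,
`ν₁*` from `4(D⁴+1)T⁴ ≤ T⁵` on, and `PT⁻⁹·T⁵ = PT⁻⁴ ≤ PT⁻²`. [cite: Zhang2022LandauSiegel, §17 (17.8) p.98] -/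
theorem bConvNuOne_eq_zero_of_le (hℓ : (5 : ℝ) ^ (10 : ℕ) ≤ ell D) {n : ℕ}
    (hn : bigP D / bigT D ^ 2 ≤ (n : ℝ)) : bConvNuOne c' χ n = 0 := by
  have hP : 0 < bigP D := Real.exp_pos _
  have hT0 : 0 < bigT D := Real.exp_pos _
  have hT1 : 1 ≤ bigT D := Real.one_le_exp (by unfold ell; positivity)
  have hsqrt : bigP D ^ (1 / 2 : ℝ) * bigP D ^ (1 / 2 : ℝ) = bigP D := by
    rw [← Real.rpow_add hP]; norm_num
  have hmax : max (Skeleton.P2 D) (Skeleton.P3 D) ≤ bigP D ^ (1 / 2 : ℝ) / bigT D ^ 9 := by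
    rw [le_div_iff₀ (pow_pos hT0 9)]; exact max_P2_P3_mul_bigT_pow_le hℓ
  have hmax0 : 0 ≤ max (Skeleton.P2 D) (Skeleton.P3 D) := le_trans (Real.rpow_nonneg hP.le _) (le_max_right _ _)
  have hS1 := four_mul_pow_four_succ_le_bigT hℓ
  unfold bConvNuOne
  refine convolution_eq_zero_of_support (fun a ha => bcoef_eq_zero_of_sqrtP_mul_max_le ha)
    (fun b hb => nuOneStar_eq_zero_of_le c' χ hb) (le_trans ?_ hn)
  calc bigP D ^ (1 / 2 : ℝ) * max (Skeleton.P2 D) (Skeleton.P3 D) * (4 * ((D : ℝ) ^ 4 + 1) * bigT D ^ 4)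
      ≤ bigP D ^ (1 / 2 : ℝ) * (bigP D ^ (1 / 2 : ℝ) / bigT D ^ 9) * (bigT D * bigT D ^ 4) := by
        refine mul_le_mul (mul_le_mul_of_nonneg_left hmax (Real.rpow_nonneg hP.le _))
          (mul_le_mul_of_nonneg_right hS1 (by positivity)) (by positivity) ?_
        exact mul_nonneg (Real.rpow_nonneg hP.le _) (div_nonneg (Real.rpow_nonneg hP.le _) (by positivity))
    _ = (bigP D ^ (1 / 2 : ℝ) * bigP D ^ (1 / 2 : ℝ)) * (bigT D ^ 5 / bigT D ^ 9) := by ring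
    _ = bigP D * (bigT D ^ 5 / bigT D ^ 9) := by rw [hsqrt]
    _ ≤ bigP D * (1 / bigT D ^ 2) := by
        refine mul_le_mul_of_nonneg_left ?_ hP.le
        rw [div_le_div_iff₀ (pow_pos hT0 9) (pow_pos hT0 2), one_mul]
        calc bigT D ^ 5 * bigT D ^ 2 = bigT D ^ 7 := by ring
          _ ≤ bigT D ^ 9 := pow_le_pow_right₀ hT1 (by norm_num)
    _ = bigP D / bigT D ^ 2 := by ring

/-- **The inline claim before (17.8) HOLDS: `(b∗ν₁*)(n)` is supported on `n < PT⁻²`** (§17 p. 98,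
"Note that the arithmetic function `(b∗ν₁*)(n)` is supported on `n < PT⁻²`"; the typed node
`Typed.Section17.Claim17_supp_bnu1`). NOTE: this does NOT follow from the printed support statement of
(15.2) alone ("`b(n) = 0` if `n > PT⁻²η₊`", with `ν₁*` living up to `≍ D⁴T⁴`); it holds because `b` is
in fact supported below `P^{1/2}max(P₂,P₃) ≤ PT⁻⁹` (`bcoef_eq_zero_of_sqrtP_mul_max_le`; cf. the cell's
`b`-support gap family G-L4t2-1). [cite: Zhang2022LandauSiegel, §17 (17.8) p.98] -/
theorem claim17_supp_bnu1_holds (c' : ℝ) : Claim17_supp_bnu1 c' := by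
  obtain ⟨D₀, hD₀⟩ := exists_nat_forall_pow_le_ell
  exact ⟨D₀, fun D _ χ hD _ _ n hn => bConvNuOne_eq_zero_of_le c' χ (hD₀ D hD) hn⟩

variable (c' : ℝ) in
/-- `Claim17_supp_bnu1` — `_holds` alias of `claim17_supp_bnu1_holds` above under the fact's exact name, stated under the
prover's own binders as section variables (appended 2026-08-28, D-0026 bookkeeping: the proof term is the
existing theorem of this file; no statement, definition or attribute is edited; no new named fact; the
ledger's debt table listed the fact unproved). [cite: Zhang2022LandauSiegel, §17 (17.8) p.98] -/
theorem _root_.Literature.NumberTheory.LFunctions.Zhang2022.Typed.Section17.Claim17_supp_bnu1_holds :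
    _root_.Literature.NumberTheory.LFunctions.Zhang2022.Typed.Section17.Claim17_supp_bnu1 c' :=
  _root_.Literature.NumberTheory.LFunctions.Zhang2022.Typed.Section17.claim17_supp_bnu1_holds (c' := c')

end Supports

end Literature.NumberTheory.LFunctions.Zhang2022.Typed.Section17

end
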